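import Literature.MathematicalPhysics.QuantumFieldTheory.Balaban1983to89.Node00.Record10
import Literature.MathematicalPhysics.QuantumFieldTheory.Balaban1983to89.B14Eq227LocalizedTerms
import Literature.MathematicalPhysics.QuantumFieldTheory.Balaban1983to89.B12ContinuousTransportInvarianceOn

/-!
# NODE 00 (YM-PLAN Track A) — K0′ COMPONENT P7: the β-VERSION PROVISO `contT` AT THE STAGE-12 RECORD — what [III] pp. 259–261
# (the analyticity clause (ii), typed as `B14.Eq227LocalizedTerms.LFHypAnalytic`) GIVES, read through (0.19) [I]: a version of
# `T_k(χ_k e^{−GF/g_k² + A_k})` continuous ON THE SMALL-FIELD DOMAIN of the next step — and what the record's field asks beyond it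

Cell `pub-ymgap`, NODE 00, seat `pub-ymgap-node00-def-K0e` (prover, K0′ row P7 of the dag-lead's `K0PRIME-COMPONENTS.md` v0; director-ym
LINE №91 ∕ R178).  [I] = [Balaban1987RG1] (CMP 109), [III] = [Balaban1988Convergent] (CMP 119), [B11] = [Balaban1985Variational] (CMP 102).
Imports NODE 00's Stage-10 record (`Node00.Record10` — the HOME of the field: `Stage9Params.Provisos₁₀.contT`; def-T's Stage-12 record 12b v2
`Node00.Record12` carries it VERBATIM as `Provisos₁₂.base : θ.toStage9Params.Provisos₁₀`, so every ₁₂ face below is `h.base.…`), lit-balaban's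
(2.26)–(2.27)(ii) ∕ (2.30) ∕ (2.41)(ii) WITH BODY (`B14Eq227LocalizedTerms`) and n09-a's on-domain module (`B12ContinuousTransportInvarianceOn`:
`isOpen_domAltOfRecord`).  KNIT-BY-NAME; count-neutral; NOTHING of Bałaban's asserted; NOT a discharge of `contT`.

THE FIELD.  `Record12`'s provisos carry, through `base : Provisos₁₀`, def-T's β-version proviso
`contT : θ.toStage8Params.HasContTransportAlong` (K0′ component P7) (`Node00.ContinuousTransportOfRecord` §4): for EVERY torus `K`, EVERY real sequence
`g : ℕ → ℝ` (no window) and every step `k < K`, the kernel transform of record (`transportOfRecord`, [III] (3.1) read as the one-step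
disintegration kernel) of the (0.19) density `ρ_k = χ_k·exp[−GF/g_k² + A_k]` — `χ_k` the SHARP indicator of the small-field domain of record
`domAltOfRecord ν K k` (def-χ's `chiFixed7`), `A_k` def-B's effective action read through the continuous-version transport `TcOfRecord` — admits a
version CONTINUOUS ON ALL OF `SU(N)^{bonds(T^{(k+1)})}` (`HasContVersion (piHaar …)`).

THE PRINT.  [I] (0.19) p. 255: `A_{k+1}(V) = log 𝐍_k⁻¹ (T_k(χ_k e^{−GF/g_k² + A_k}))(V)`, i.e. `(T_kρ_k)(V) = 𝐍_k·exp A_{k+1}(V)`; [I] p. 259 ∕ (1.2)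
p. 260: `A_{k+1}` is considered «on the space of configurations V for which |∂V − 1| < ε₀» (the small-field domain); [III] (2.23) p. 258 with
(2.26)–(2.27)(ii) p. 259, (2.30) p. 260, (2.41)(ii) p. 261 (= Theorem 1 [III] p. 262 at every `k`): `A_{k+1}` is a finite sum of smeared Wilson
actions and of localized terms `𝐄^{(j)}(X, (𝐔,𝐉), z)`, `𝐑^{(j)}(X, ·)`, `𝐁^{(j)}(X, ·, A, {S_i})` each «an analytic function of the variables
(𝐔,𝐉) ∈ U^c_j(X, α_{0,j}, α_{1,j})» read at the background `(U_{k+1}(V), J(U_{k+1}(V)))`, itself analytic in `V` on the small-field domain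
([B11] Thm 1).  HENCE, IN PRINT: `V ↦ (T_kρ_k)(V)` is continuous (indeed real-analytic) ON THE SMALL-FIELD DOMAIN OF STEP `k+1`.  Print says
nothing about `T_kρ_k` OFF that domain (large fields are the business of the 𝐑-operation [IV], not of `𝐓_k`).

WHAT THIS FILE TYPES AND PROVES (0 `sorry`; definitions = the on-domain predicates only; theorems = kernel bookkeeping + one continuity lemma).
* §1 (generic) ON-DOMAIN CONTINUOUS VERSIONS — the desk sketch of node00-def-T g2 (`SKETCH-ContinuousTransportOnDomain.lean`, ref-D READ #76
  (L1), never filed), landed here with its names: `HasContVersionOn μ f s`; `HasContVersion.on` (everywhere ⇒ on every `s`);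
  `hasContVersionOn_congr_ae`; `eqOn_of_continuousOn_of_ae_eq` (DETERMINACY ON AN OPEN `s` for an open-positive `μ`, Mathlib
  `Measure.eqOn_open_of_ae_eq`); `hasContVersionOn_univ_iff` (on `univ` it IS the everywhere notion).
* §2 AT THE RECORD: `HasContTransportOn F N K k ρ s` (the kernel transform of `ρ` has a version continuous ON `s`), `HasContTransportAt.on`,
  `hasContTransportAt_iff_on_univ`; the θ-level provisos `Stage8Params.HasContTransportAlongOn θ T dom` (any transport family `T`, any domain
  family) and **`Stage8Params.HasContTransportAlongDom θ T`** := the same at `dom K g (k+1) := domAltOfRecord θ.ν K (k+1)` — THE PRINT-SHAPED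
  PROVISO; `Stage8Params.HasContTransportAlong.on ∕ .dom` and `Stage9Params.Provisos₁₀.hasContTransportAlongDom` (the record's everywhere
  field IMPLIES the print-shaped one at `T := TcOfRecord`; at Stage 12: `h.base.hasContTransportAlongDom`).
* §3 THE (0.19)-SHAPED CONSTRUCTORS, side by side: `hasContTransportOn_of_exp_repr` — if `(T_kρ)(V) = 𝐍·exp A'(V)` for a.e. `V ∈ s` with `A'`
  continuous ON `s`, the on-domain proviso holds on `s`; `hasContTransportAt_of_exp_repr` — the record's EVERYWHERE field at one density follows
  from the SAME identity a.e. ON THE WHOLE SPACE with `A'` continuous EVERYWHERE.  The difference between the two hypotheses — a continuous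
  exponential representation of `T_kρ_k` OFF the small-field domain — is exactly what the everywhere field asks beyond print (see LOCATED below).
* §4 THE B14 KNIT (lit-balaban's (ii) consumed where print consumes it): `continuousOn_action23_chart_of_analytic` — under `LFHypAnalytic T c n`
  ((2.27)(ii) ∕ (2.30) ∕ (2.41)(ii)), the history in the window `0 ≤ g_{j−1} ≤ γ` (where `LFHypAnalytic` speaks), a chart `bg` (print: the background
  `V ↦ U_{k+1}(V)`) with `V ↦ T.ofBackground (bg V)` continuous ON `s` and mapping `s` into every analyticity space `U^c_j(X, α_{0,j}, α_{1,j})` ∕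
  `Ũ^c_j(X)` (print: [III] p. 259 «(2.7) imply U_k ∈ U^c_j(X, α_{0,j}, α_{1,j})»), and the two smeared Wilson pieces of (2.23) continuous along the
  chart, the (2.23) action `V ↦ D.action23 n (bg V)` (`Step.LFActionData.action23`, every index predicate — in particular the realised ranges of
  `B14.Eq227LocalizedTerms.realise`) is `ContinuousOn s`.
* §5 `hasContTransportOn_of_analytic_repr` = §3 ∘ §4 at one torus ∕ step ∕ domain, and `hasContTransportOn_domAlt_of_analytic_repr` at
  `s := domAltOfRecord ν K (k+1)` (OPEN: n09-a's `isOpen_domAltOfRecord`): the ON-DOMAIN proviso at one β-input FROM (ii) + the chart data + the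
  identification `T_kρ_k = 𝐍_k e^{A_{k+1}}` a.e. on the domain with `A_{k+1}` in the (2.23) form there.

LOCATED (seat finding [NODE00-K0E-G0-LOCATED-1], pub-ymgap INBOX 2026-08-26; for the dag-lead's MISSING-ESTIMATE-LOG and the record's owner):
(L-K0e-1) pp. 259–261 of [III] give the ON-DOMAIN proviso (§5), NOT the record's everywhere field.  The everywhere field additionally asks — at
every torus, every UNWINDOWED history `g`, every `k < K` — a version of `T_kρ_k` continuous ACROSS the boundary of the small-field domain and on
the large-field region, where `ρ_k` carries the sharp indicator `𝟙_{domAltOfRecord}` and where the averaging of record `blockAvg expMeanLogSU` is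
itself DISCONTINUOUS in the configuration (tree: `BlockAveragingExpMeanLogContinuous`, header; cell ym3-torus R-flag D2-CONT): a fibre-boundary
regularity statement about push-forwards under (0.4), not a statement of [I] ∕ [III].  (L-K0e-2) Even the on-domain knit (§5) has three by-name
inputs that are NODES, not bookkeeping: the (2.23) representation of the record's `A_{k+1}` on the domain (N11 = [III] Thm 1; N09 = [I] (0.23));
continuity of def-B's background `Uk` on the domain ([B11] Thm 1 — analytic dependence of the minimiser; not in the tree); and `T_kρ_k = 𝐍_k e^{A_{k+1}}`
a.e. on the domain as a law about the KERNEL transform ((0.19) read on versions).  Row P7 is therefore not closable by a knit of typed material;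
this file makes both gaps kernel-displayed shapes.  Nothing here modifies `Record10`∕`Record12`; whether a successor record carries `HasContTransportAlongDom`
(with an on-domain continuous-version transport) instead of `HasContTransportAlong` is the type owner's decision (node00-def-T), not this file's.

HONEST FRAMING: definitions of two on-domain predicates + kernel-checked bookkeeping (Mathlib's uniqueness of continuous versions on open sets,
`ContinuousOn` algebra, `AnalyticOnNhd.continuousOn`); nothing of Bałaban's asserted; no estimate; counts unmoved (typed 28∕28 · discharged 5∕28);
K0′ NOT closed, `contT` NOT discharged; one finite four-torus programme at fixed `ε = L^{−K}` — NOT continuum ∕ ℝ⁴ ∕ OS ∕ mass gap ∕ Clay.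
No `sorry`, no `axiom`, no `instance`, no `notation`.
-/

noncomputable section

open MeasureTheory Set
open scoped BigOperators

namespace Literature.MathematicalPhysics.QuantumFieldTheory.Balaban1983to89.Node00

open _root_.Topology
open T4Continuum (T4Family)
open B12Eq019ActionBody (integrand)
open Step (LFTower LFConsts LFActionData)
open B14.Eq227LocalizedTerms (LFHypAnalytic)
open B12ContinuousTransportInvarianceOn (isOpen_domAltOfRecord)

/-! ## §1. Continuous versions ON A DOMAIN (generic) -/

section Generic

variable {α : Type*} [TopologicalSpace α] [MeasurableSpace α]

/-- `f` admits a version continuous ON `s` w.r.t. `μ`: some `g`, continuous on `s`, with `g = f` for `μ`-a.e. point of `s`.  (node00-def-T's desk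
sketch (L1), landed.) [cite: Balaban1987RG1, (0.13) p.254 and p.259 (bookkeeping: the on-domain reading of the transform)] -/
def HasContVersionOn (μ : Measure α) (f : α → ℝ) (s : Set α) : Prop :=
  ∃ g : α → ℝ, ContinuousOn g s ∧ g =ᵐ[μ.restrict s] f

/-- An everywhere continuous version is an on-domain one, on every `s`. [cite: Balaban1987RG1, (0.13) p.254 (bookkeeping)] -/
theorem HasContVersion.on {μ : Measure α} {f : α → ℝ} (h : HasContVersion μ f) (s : Set α) : HasContVersionOn μ f s := by
  obtain ⟨g, hg, hae⟩ := h
  exact ⟨g, hg.continuousOn, ae_restrict_of_ae hae⟩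

/-- On-domain continuous versions depend only on the a.e.-class on the domain. [cite: Balaban1987RG1, (0.13) p.254 (bookkeeping)] -/
theorem hasContVersionOn_congr_ae {μ : Measure α} {f₁ f₂ : α → ℝ} {s : Set α} (h : f₁ =ᵐ[μ.restrict s] f₂) :
    HasContVersionOn μ f₁ s ↔ HasContVersionOn μ f₂ s :=
  ⟨fun ⟨g, hg, hgf⟩ => ⟨g, hg, hgf.trans h⟩, fun ⟨g, hg, hgf⟩ => ⟨g, hg, hgf.trans h.symm⟩⟩

/-- On `univ` the on-domain notion IS the everywhere one. [cite: Balaban1987RG1, (0.13) p.254 (bookkeeping)] -/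
theorem hasContVersionOn_univ_iff {μ : Measure α} {f : α → ℝ} : HasContVersionOn μ f univ ↔ HasContVersion μ f := by
  constructor
  · rintro ⟨g, hg, hae⟩
    exact ⟨g, continuousOn_univ.1 hg, by rwa [Measure.restrict_univ] at hae⟩
  · intro h
    exact h.on univ

/-- **DETERMINACY ON AN OPEN DOMAIN**: two functions continuous on an OPEN `s` and a.e.-equal on `s` w.r.t. a measure charging every non-empty open
set AGREE AT EVERY POINT OF `s` (Mathlib `Measure.eqOn_open_of_ae_eq`) — an on-domain continuous version, when it exists, is pointwise determined
on the domain by the a.e.-class. [cite: Balaban1987RG1, (0.13) p.254 (bookkeeping)] -/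
theorem eqOn_of_continuousOn_of_ae_eq [OpensMeasurableSpace α] {μ : Measure α} [μ.IsOpenPosMeasure] {f g : α → ℝ} {s : Set α}
    (hs : IsOpen s) (hf : ContinuousOn f s) (hg : ContinuousOn g s) (hae : f =ᵐ[μ.restrict s] g) : EqOn f g s :=
  Measure.eqOn_open_of_ae_eq hae hs hf hg

/-- The (0.19)-shaped constructor, generic: if `f = c·exp ∘ A'` a.e. on `s` with `A'` continuous on `s`, then `f` has a version continuous on `s`.
[cite: Balaban1987RG1, (0.19) p.255 (bookkeeping)] -/
theorem hasContVersionOn_of_exp_repr {μ : Measure α} {f : α → ℝ} {s : Set α} {A' : α → ℝ} (hA' : ContinuousOn A' s) (c : ℝ)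
    (hae : ∀ᵐ x ∂μ.restrict s, f x = c * Real.exp (A' x)) : HasContVersionOn μ f s :=
  ⟨fun x => c * Real.exp (A' x), continuousOn_const.mul (Real.continuous_exp.comp_continuousOn hA'),
    hae.mono fun _ hx => hx.symm⟩

/-- The everywhere twin: `f = c·exp ∘ A'` a.e. with `A'` continuous EVERYWHERE gives an everywhere continuous version.
[cite: Balaban1987RG1, (0.19) p.255 (bookkeeping)] -/
theorem hasContVersion_of_exp_repr {μ : Measure α} {f : α → ℝ} {A' : α → ℝ} (hA' : Continuous A') (c : ℝ)
    (hae : ∀ᵐ x ∂μ, f x = c * Real.exp (A' x)) : HasContVersion μ f :=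
  ⟨fun x => c * Real.exp (A' x), continuous_const.mul (Real.continuous_exp.comp hA'), hae.mono fun _ hx => hx.symm⟩

end Generic

/-! ## §2. At the record: the on-domain transport provisos, and the record's everywhere field implies them -/

section Record

variable (F : T4Family) (N : ℕ) [NeZero N]

/-- **ON-DOMAIN β-VERSION PROVISO AT ONE DENSITY**: the kernel transform of record of `ρ` at torus `K`, step `k`, has a version continuous ON the set
`s` of coarse fields (def-T's desk sketch (L1)). [cite: Balaban1987RG1, (0.13) p.254 and p.259] -/
def HasContTransportOn (K k : ℕ) (ρ : Density (F.P K) k (SU N)) (s : Set (PBond (F.P K) (k + 1) → SU N)) : Prop :=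
  HasContVersionOn (piHaar (F.P K) (k + 1) (SU N)) (fun V => transportOfRecord F N K k ρ V) s

variable {F N}

/-- The record's everywhere proviso at one density implies the on-domain one on every `s`. [cite: Balaban1987RG1, (0.13) p.254 (bookkeeping)] -/
theorem HasContTransportAt.on {K k : ℕ} {ρ : Density (F.P K) k (SU N)} (h : HasContTransportAt F N K k ρ)
    (s : Set (PBond (F.P K) (k + 1) → SU N)) : HasContTransportOn F N K k ρ s :=
  HasContVersion.on h s

/-- … and on `univ` the two coincide. [cite: Balaban1987RG1, (0.13) p.254 (bookkeeping)] -/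
theorem hasContTransportAt_iff_on_univ {K k : ℕ} {ρ : Density (F.P K) k (SU N)} :
    HasContTransportAt F N K k ρ ↔ HasContTransportOn F N K k ρ univ :=
  hasContVersionOn_univ_iff.symm

/-- **DETERMINACY AT THE RECORD, ON AN OPEN DOMAIN**: two versions of the transform of record continuous on an open `s` agree on `s` (product Haar
measure on `SU(N)^{bonds}` charges open sets: def-T's `isOpenPosMeasure_piHaar_SUN`). [cite: Balaban1987RG1, (0.13) p.254 (bookkeeping)] -/
theorem eqOn_of_hasContTransportOn {K k : ℕ} {ρ : Density (F.P K) k (SU N)} {s : Set (PBond (F.P K) (k + 1) → SU N)} (hs : IsOpen s)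
    {g₁ g₂ : (PBond (F.P K) (k + 1) → SU N) → ℝ} (h₁ : ContinuousOn g₁ s) (h₂ : ContinuousOn g₂ s)
    (hae₁ : g₁ =ᵐ[(piHaar (F.P K) (k + 1) (SU N)).restrict s] fun V => transportOfRecord F N K k ρ V)
    (hae₂ : g₂ =ᵐ[(piHaar (F.P K) (k + 1) (SU N)).restrict s] fun V => transportOfRecord F N K k ρ V) : EqOn g₁ g₂ s :=
  haveI := isOpenPosMeasure_piHaar_SUN N (F.P K) (k + 1)
  eqOn_of_continuousOn_of_ae_eq hs h₁ h₂ (hae₁.trans hae₂.symm)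

variable (F N)

/-- **θ-LEVEL ON-DOMAIN PROVISO along a domain family** (any transport family `T`, def-χ's `chiFixed7 θ.ν` in the χ slot): at every torus `K`,
history `g` and step `k < K`, the (0.19) density `χ_k·exp[−GF/g_k² + A_k]` built over `T` has a transform of record with a version continuous ON
`dom K g (k+1)`.  (def-T's desk sketch (L1).) [cite: Balaban1987RG1, (0.13) p.254, (0.19) p.255 and p.259] -/
def Stage8Params.HasContTransportAlongOn (θ : Stage8Params F N) (T : Transport F N)
    (dom : (K : ℕ) → (ℕ → ℝ) → (k : ℕ) → Set (PBond (F.P K) k → SU N)) : Prop :=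
  ∀ (K : ℕ) (g : ℕ → ℝ) (k : ℕ), k < K →
    HasContTransportOn F N K k
      (integrand (chiFixed7 F N θ.ν K g k) (gfOfRecord F N K k) (g k) (effActionHT F N T (chiFixed7 F N θ.ν) K g k)) (dom K g (k + 1))

/-- **THE PRINT-SHAPED PROVISO** `HasContTransportAlongDom θ T`: the on-domain proviso at the record's own small-field domains of the NEXT step,
`dom K g (k+1) := domAltOfRecord θ.ν K (k+1)` = «|∂V − 1| < ε₀ on T₁^{(k+1)}» ([I] p. 259, the domain on which print reads `A_{k+1}`).
[cite: Balaban1987RG1, p.259 and (1.2) p.260; Balaban1988Convergent, (2.23) p.258] -/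
def Stage8Params.HasContTransportAlongDom (θ : Stage8Params F N) (T : Transport F N) : Prop :=
  θ.HasContTransportAlongOn F N T fun K _ k => domAltOfRecord F N θ.ν K k

variable {F N}

/-- The record's everywhere proviso implies the on-domain one along every domain family, at `T := TcOfRecord`.
[cite: Balaban1987RG1, (0.13) p.254 (bookkeeping)] -/
theorem Stage8Params.HasContTransportAlong.on {θ : Stage8Params F N} (h : θ.HasContTransportAlong)
    (dom : (K : ℕ) → (ℕ → ℝ) → (k : ℕ) → Set (PBond (F.P K) k → SU N)) : θ.HasContTransportAlongOn F N (TcOfRecord F N) dom :=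
  fun K g k hk => (h K g k hk).on _

/-- … in particular the print-shaped proviso. [cite: Balaban1987RG1, (0.13) p.254 and p.259 (bookkeeping)] -/
theorem Stage8Params.HasContTransportAlong.dom {θ : Stage8Params F N} (h : θ.HasContTransportAlong) :
    θ.HasContTransportAlongDom F N (TcOfRecord F N) :=
  h.on _

/-- **A RECORD'S PROVISOS CARRY THE PRINT-SHAPED PROVISO** (Stage 10, the home of `contT`; at def-T's Stage-12 record 12b:
`(h : θ.Provisos₁₂ F N) ↦ h.base.hasContTransportAlongDom`). [cite: Balaban1987RG1, (0.13) p.254 and p.259 (bookkeeping)] -/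
theorem Stage9Params.Provisos₁₀.hasContTransportAlongDom {θ : Stage9Params F N} (h : θ.Provisos₁₀) :
    θ.toStage8Params.HasContTransportAlongDom F N (TcOfRecord F N) :=
  h.contT.dom

/-! ## §3. The (0.19)-shaped constructors at the record: on a domain vs everywhere -/

/-- **(0.19) ON A DOMAIN ⇒ the on-domain proviso**: if `(T_kρ)(V) = 𝐍·exp A'(V)` for a.e. `V ∈ s` and `A'` is continuous ON `s`, the kernel transform
of `ρ` has a version continuous on `s` (namely `𝐍·e^{A'}`). [cite: Balaban1987RG1, (0.19) p.255 and p.259] -/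
theorem hasContTransportOn_of_exp_repr {K k : ℕ} {ρ : Density (F.P K) k (SU N)} {s : Set (PBond (F.P K) (k + 1) → SU N)}
    {A' : (PBond (F.P K) (k + 1) → SU N) → ℝ} (hA' : ContinuousOn A' s) (Nk : ℝ)
    (hae : ∀ᵐ V ∂(piHaar (F.P K) (k + 1) (SU N)).restrict s, transportOfRecord F N K k ρ V = Nk * Real.exp (A' V)) :
    HasContTransportOn F N K k ρ s :=
  hasContVersionOn_of_exp_repr hA' Nk hae

/-- **(0.19) EVERYWHERE ⇒ the record's everywhere field at one density**: the SAME identity a.e. on the whole configuration space with `A'` continuous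
EVERYWHERE.  Side by side with `hasContTransportOn_of_exp_repr` this displays what `HasContTransportAt` asks beyond the on-domain form: a continuous
exponential representation of `T_kρ` off the small-field domain. [cite: Balaban1987RG1, (0.19) p.255 (bookkeeping)] -/
theorem hasContTransportAt_of_exp_repr {K k : ℕ} {ρ : Density (F.P K) k (SU N)} {A' : (PBond (F.P K) (k + 1) → SU N) → ℝ}
    (hA' : Continuous A') (Nk : ℝ) (hae : ∀ᵐ V ∂piHaar (F.P K) (k + 1) (SU N), transportOfRecord F N K k ρ V = Nk * Real.exp (A' V)) :
    HasContTransportAt F N K k ρ :=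
  hasContVersion_of_exp_repr hA' Nk hae

end Record

/-! ## §4. The B14 knit: (2.27)(ii) ∕ (2.30) ∕ (2.41)(ii) ⇒ the (2.23) action is continuous along a chart into the analyticity spaces -/

section B14Knit

variable {P : Params} {G : Type*} [GaugeGroup G] {Φ 𝒢 𝔄 : Type*} [NormedAddCommGroup Φ] [NormedSpace ℂ Φ]
variable {T : LFTower P G Φ 𝒢 𝔄} {c : LFConsts} {n : ℕ}
variable {E : Type*} [TopologicalSpace E] {s : Set E} {bg : E → GaugeField P 0 G}

/-- One localized 𝐄-term of (2.23) read along the chart is continuous on `s`: (ii) (holomorphy on `U^c_j(X, α_{0,j}, α_{1,j})`) composed with a chart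
continuous on `s` mapping `s` into the space, real part taken. [cite: Balaban1988Convergent, (2.27)(ii) p.259] -/
theorem continuousOn_re_E_chart (h : LFHypAnalytic T c n) {j : ℕ} (h1 : 1 ≤ j) (hj : j ≤ n) (X : (T.sys j).Dom) (z : T.Pt j)
    {g : ℝ} (hg0 : 0 ≤ g) (hgγ : g ≤ c.γ) (hch : ContinuousOn (fun e => T.ofBackground (bg e)) s)
    (hmaps : MapsTo (fun e => T.ofBackground (bg e)) s (T.space j X (c.alpha0 (T.flow.g j)) (c.alpha1 (T.flow.g j)))) :
    ContinuousOn (fun e => (T.E j X z g (T.ofBackground (bg e))).re) s :=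
  Complex.continuous_re.comp_continuousOn ((h.continuousOn_E h1 hj X z hg0 hgγ).comp hch hmaps)

/-- The same for a localized 𝐑-term ((2.30)(ii)). [cite: Balaban1988Convergent, (2.30) p.260] -/
theorem continuousOn_re_R_chart (h : LFHypAnalytic T c n) {j : ℕ} (h1 : 1 ≤ j) (hj : j ≤ n) (X : (T.sys j).Dom)
    (hch : ContinuousOn (fun e => T.ofBackground (bg e)) s)
    (hmaps : MapsTo (fun e => T.ofBackground (bg e)) s (T.space j X (c.alpha0 (T.flow.g j)) (c.alpha1 (T.flow.g j)))) :
    ContinuousOn (fun e => (T.R j X (T.ofBackground (bg e))).re) s :=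
  Complex.continuous_re.comp_continuousOn ((h.continuousOn_R h1 hj X).comp hch hmaps)

/-- The same for a localized 𝐁-term on `Ũ^c_j(X)` ((2.41)(ii)). [cite: Balaban1988Convergent, (2.41)(ii) p.261] -/
theorem continuousOn_re_B_chart (h : LFHypAnalytic T c n) {j : ℕ} (h1 : 1 ≤ j) (hj : j ≤ n) (X : (T.sys j).Dom) (a : 𝔄)
    (hch : ContinuousOn (fun e => T.ofBackground (bg e)) s) (hmaps : MapsTo (fun e => T.ofBackground (bg e)) s (T.spaceB j X)) :
    ContinuousOn (fun e => (T.B j X (T.ofBackground (bg e)) a).re) s :=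
  Complex.continuous_re.comp_continuousOn (((h.analyticB j h1 hj X a).continuousOn).comp hch hmaps)

/-- **THE (2.23) ACTION IS CONTINUOUS ALONG A CHART INTO THE ANALYTICITY SPACES.**  Under the analyticity clause `LFHypAnalytic T c n` of the
inductive description ((2.27)(ii), (2.30), (2.41)(ii) — [III] pp. 259–261), with the history in the window `0 ≤ g_{j−1} ≤ γ` for `1 ≤ j ≤ n`, a chart
`bg` (print: the background `U_{n}(V)` of the coarse field) such that `e ↦ T.ofBackground (bg e)` is continuous on `s` and maps `s` into every space
`U^c_j(X, α_{0,j}, α_{1,j})` and `Ũ^c_j(X)` (print: [III] p. 259 «(2.7) imply U_k ∈ U^c_j(X, α_{0,j}, α_{1,j})»), and the smeared Wilson pieces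
`A(1/g_n²(·), ·)`, `A(φ_j, ·)` of (2.23)∕(2.25) continuous along the chart, the action `e ↦ A_n(bg e)` = `D.action23 n (bg e)` is continuous ON `s`
(finite sums; the subtracted values at `U = 1` are constants). [cite: Balaban1988Convergent, (2.23) p.258, (2.27)(ii) p.259, (2.30) p.260, (2.41)(ii) p.261] -/
theorem continuousOn_action23_chart_of_analytic (h : LFHypAnalytic T c n) (D : LFActionData P G T)
    (hwin : ∀ j, 1 ≤ j → j ≤ n → 0 ≤ T.flow.g (j - 1) ∧ T.flow.g (j - 1) ≤ c.γ)
    (hch : ContinuousOn (fun e => T.ofBackground (bg e)) s)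
    (hmaps : ∀ j, 1 ≤ j → j ≤ n → ∀ X : (T.sys j).Dom,
      MapsTo (fun e => T.ofBackground (bg e)) s (T.space j X (c.alpha0 (T.flow.g j)) (c.alpha1 (T.flow.g j))))
    (hmapsB : ∀ j, 1 ≤ j → j ≤ n → ∀ X : (T.sys j).Dom, MapsTo (fun e => T.ofBackground (bg e)) s (T.spaceB j X))
    (hWL : ContinuousOn (fun e => D.wilsonLocal (bg e)) s) (hWφ : ∀ j, 1 ≤ j → j ≤ n → ContinuousOn (fun e => D.wilsonPhi j (bg e)) s) :
    ContinuousOn (fun e => D.action23 n (bg e)) s := by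
  unfold LFActionData.action23
  refine ((((hWL.neg).add ?_).add ?_).add ?_).sub continuousOn_const
  · refine continuousOn_finsetSum _ fun j hjm => ?_
    obtain ⟨h1, hj⟩ := Finset.mem_Icc.mp hjm
    refine ContinuousOn.sub ?_ (continuousOn_const.mul (hWφ j h1 hj))
    refine continuousOn_finsetSum _ fun X _ => continuousOn_finsetSum _ fun z _ => ?_
    by_cases hb : D.admE j X z = true
    · simp only [hb, ↓reduceIte]
      exact (continuousOn_re_E_chart h h1 hj X z (hwin j h1 hj).1 (hwin j h1 hj).2 hch (hmaps j h1 hj X)).sub continuousOn_const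
    · simp only [hb, Bool.false_eq_true, ↓reduceIte]
      exact continuousOn_const
  · refine continuousOn_finsetSum _ fun j hjm => ?_
    obtain ⟨h1, hj⟩ := Finset.mem_Icc.mp hjm
    refine continuousOn_finsetSum _ fun X _ => ?_
    by_cases hb : D.admR j X = true
    · simp only [hb, ↓reduceIte]
      exact (continuousOn_re_R_chart h h1 hj X hch (hmaps j h1 hj X)).sub continuousOn_const
    · simp only [hb, Bool.false_eq_true, ↓reduceIte]
      exact continuousOn_const
  · refine continuousOn_finsetSum _ fun j hjm => ?_
    obtain ⟨h1, hj⟩ := Finset.mem_Icc.mp hjm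
    refine continuousOn_finsetSum _ fun X _ => ?_
    by_cases hb : D.admB j X = true
    · simp only [hb, ↓reduceIte]
      exact continuousOn_re_B_chart h h1 hj X D.fluct hch (hmapsB j h1 hj X)
    · simp only [hb, Bool.false_eq_true, ↓reduceIte]
      exact continuousOn_const

end B14Knit

/-! ## §5. §3 ∘ §4 at the record: the on-domain proviso at one β-input from (ii) + chart data + the (0.19)∕(2.23) identification -/

section Knit

variable {F : T4Family} {N : ℕ} [NeZero N]

/-- **ON-DOMAIN PROVISO AT ONE DENSITY FROM THE B14 INDUCTIVE DESCRIPTION.**  At torus `K`, step `k`, density `ρ` and a set `s` of coarse fields: given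
an inductive description on the torus `F.P K` (a tower `Tw` with `LFHypAnalytic Tw c n`, action data `D`, history in the window), a chart `bg` into its
background with the continuity ∕ inclusion data of `continuousOn_action23_chart_of_analytic` on `s`, and the identification «`(T_kρ)(V) = 𝐍·exp A_n(bg V)`
for a.e. `V ∈ s`» ((0.19) [I] with `A_{k+1}` in the form (2.23) [III] — the content of Theorem 1 [III] at the record, NOT asserted), the kernel transform of
`ρ` has a version continuous ON `s`. [cite: Balaban1987RG1, (0.19) p.255 and p.259; Balaban1988Convergent, (2.23) p.258, (2.27)(ii) p.259, Thm 1 p.262] -/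
theorem hasContTransportOn_of_analytic_repr {K k : ℕ} (ρ : Density (F.P K) k (SU N)) (s : Set (PBond (F.P K) (k + 1) → SU N))
    {Φ 𝒢 𝔄 : Type*} [NormedAddCommGroup Φ] [NormedSpace ℂ Φ] {Tw : LFTower (F.P K) (SU N) Φ 𝒢 𝔄} {c : LFConsts} {n : ℕ}
    (hA : LFHypAnalytic Tw c n) (D : LFActionData (F.P K) (SU N) Tw)
    (hwin : ∀ j, 1 ≤ j → j ≤ n → 0 ≤ Tw.flow.g (j - 1) ∧ Tw.flow.g (j - 1) ≤ c.γ)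
    {bg : (PBond (F.P K) (k + 1) → SU N) → GaugeField (F.P K) 0 (SU N)}
    (hch : ContinuousOn (fun V => Tw.ofBackground (bg V)) s)
    (hmaps : ∀ j, 1 ≤ j → j ≤ n → ∀ X : (Tw.sys j).Dom,
      MapsTo (fun V => Tw.ofBackground (bg V)) s (Tw.space j X (c.alpha0 (Tw.flow.g j)) (c.alpha1 (Tw.flow.g j))))
    (hmapsB : ∀ j, 1 ≤ j → j ≤ n → ∀ X : (Tw.sys j).Dom, MapsTo (fun V => Tw.ofBackground (bg V)) s (Tw.spaceB j X))
    (hWL : ContinuousOn (fun V => D.wilsonLocal (bg V)) s) (hWφ : ∀ j, 1 ≤ j → j ≤ n → ContinuousOn (fun V => D.wilsonPhi j (bg V)) s)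
    (Nk : ℝ) (hae : ∀ᵐ V ∂(piHaar (F.P K) (k + 1) (SU N)).restrict s, transportOfRecord F N K k ρ V = Nk * Real.exp (D.action23 n (bg V))) :
    HasContTransportOn F N K k ρ s :=
  hasContTransportOn_of_exp_repr (continuousOn_action23_chart_of_analytic hA D hwin hch hmaps hmapsB hWL hWφ) Nk hae

/-- **The same AT THE RECORD'S SMALL-FIELD DOMAIN OF THE NEXT STEP** `s := domAltOfRecord ν K (k+1)` — an OPEN set (n09-a's `isOpen_domAltOfRecord`), so
the version obtained is pointwise DETERMINED there (`eqOn_of_hasContTransportOn`).  This is the β-input shape of `HasContTransportAlongDom` at one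
`(K, g, k)`; the three displayed inputs (chart continuity = [B11] Thm 1, inclusion = [III] p. 259 «(2.7) imply …», identification = (0.19)+(2.23)) are
nodes of the route, consumed BY NAME, asserted nowhere. [cite: Balaban1987RG1, (0.19) p.255, p.259 and (1.2) p.260; Balaban1988Convergent, (2.23) p.258, Thm 1 p.262] -/
theorem hasContTransportOn_domAlt_of_analytic_repr (ν : Stage7Numerics) {K k : ℕ} (ρ : Density (F.P K) k (SU N))
    {Φ 𝒢 𝔄 : Type*} [NormedAddCommGroup Φ] [NormedSpace ℂ Φ] {Tw : LFTower (F.P K) (SU N) Φ 𝒢 𝔄} {c : LFConsts} {n : ℕ}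
    (hA : LFHypAnalytic Tw c n) (D : LFActionData (F.P K) (SU N) Tw)
    (hwin : ∀ j, 1 ≤ j → j ≤ n → 0 ≤ Tw.flow.g (j - 1) ∧ Tw.flow.g (j - 1) ≤ c.γ)
    {bg : (PBond (F.P K) (k + 1) → SU N) → GaugeField (F.P K) 0 (SU N)}
    (hch : ContinuousOn (fun V => Tw.ofBackground (bg V)) (domAltOfRecord F N ν K (k + 1)))
    (hmaps : ∀ j, 1 ≤ j → j ≤ n → ∀ X : (Tw.sys j).Dom, MapsTo (fun V => Tw.ofBackground (bg V)) (domAltOfRecord F N ν K (k + 1))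
      (Tw.space j X (c.alpha0 (Tw.flow.g j)) (c.alpha1 (Tw.flow.g j))))
    (hmapsB : ∀ j, 1 ≤ j → j ≤ n → ∀ X : (Tw.sys j).Dom,
      MapsTo (fun V => Tw.ofBackground (bg V)) (domAltOfRecord F N ν K (k + 1)) (Tw.spaceB j X))
    (hWL : ContinuousOn (fun V => D.wilsonLocal (bg V)) (domAltOfRecord F N ν K (k + 1)))
    (hWφ : ∀ j, 1 ≤ j → j ≤ n → ContinuousOn (fun V => D.wilsonPhi j (bg V)) (domAltOfRecord F N ν K (k + 1)))
    (Nk : ℝ) (hae : ∀ᵐ V ∂(piHaar (F.P K) (k + 1) (SU N)).restrict (domAltOfRecord F N ν K (k + 1)),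
      transportOfRecord F N K k ρ V = Nk * Real.exp (D.action23 n (bg V))) :
    HasContTransportOn F N K k ρ (domAltOfRecord F N ν K (k + 1)) ∧ IsOpen (domAltOfRecord F N ν K (k + 1)) :=
  ⟨hasContTransportOn_of_analytic_repr ρ _ hA D hwin hch hmaps hmapsB hWL hWφ Nk hae, isOpen_domAltOfRecord ν K (k + 1)⟩

end Knit

end Literature.MathematicalPhysics.QuantumFieldTheory.Balaban1983to89.Node00

end
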